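import Mathlib.LinearAlgebra.Projectivization.Cardinality
import Mathlib.FieldTheory.Minpoly.Basic
import Mathlib.RingTheory.Polynomial.Basic
import Literature.NumberTheory.DiophantineGeometry.FunctionFieldAdelesProofs
import Literature.NumberTheory.DiophantineGeometry.FunctionFieldGenusEllZeroProofs
import Literature.NumberTheory.DiophantineGeometry.FunctionFieldGenusDegreePosProofs
import Literature.NumberTheory.DiophantineGeometry.FunctionFieldGenusProofs
import HarnessLib

/-!
# Divisor classes of a function field over a finite field: class number and the numbers `A_n`
(Stichtenoth §5.1, Lemma 5.1.1 – Lemma 5.1.4)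

Trunk ArithGeomL, continuing `FunctionFieldDivisors` / `FunctionFieldGenus` (places `PlaceOver K F`,
divisors, `ℓ(D)`, genus, Riemann–Roch — the latter *proved* in `FunctionFieldAdelesProofs`). This
file is the first half of Stichtenoth, *Algebraic Function Fields and Codes*, §5.1 (The Zeta
Function of a Function Field), namely everything before the zeta function itself is introduced
(Def. 5.1.5): the purely algebraic counting results. Everything is **proved** (no named facts).

## Main definitions

* `principalDivisors K F : AddSubgroup (Divisor K F)` — `Princ(F/K)` (Def. 1.4.3), and
  `DivisorClass K F = Div(F/K) ⧸ Princ(F/K)` — the divisor class group `Cl(F/K)`, with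
  `DivisorClass.degree : Cl(F/K) →+ ℤ` and `DivisorClass.ell` (well defined by Cor. 1.4.12 and
  Lemma 1.4.6 (b)); `classesOfDegree n = Clⁿ(F)`; `classNumber K F = h = |Cl⁰(F)|` (Prop. 5.1.3).
* `minPosDegree K F = ∂ = min {deg A | deg A > 0}` (Stichtenoth (5.3)).
* `numPosDivisors K F n = A_n = |{A ≥ 0 | deg A = n}|` (Stichtenoth (5.4)).

## Main statements (all proved; `K` finite where counting is involved)

* `finite_setOf_degree_le`, `finite_setOf_nonneg_degree_eq` — **Lemma 5.1.1**: finitely many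
  places of degree `≤ n`, finitely many positive divisors of degree `n`.
* `exists_nonneg_isLinearlyEquivalent` — (5.1): a class of degree `≥ g` contains a positive
  divisor; `finite_classesOfDegree` — **Prop. 5.1.3**: `Clⁿ(F)` is finite for every `n` (so
  `h < ∞`); `natCard_classesOfDegree_of_dvd` — `|Clⁿ(F)| = h` for `∂ ∣ n`,
  `classesOfDegree_eq_empty_of_not_dvd`; `minPosDegree_dvd_degree` — `∂ ∣ deg A`.
* `numPosDivisors_eq_zero_of_not_dvd` — **Lemma 5.1.4 (a)**;
  `natCard_nonneg_isLinearlyEquivalent_mul` — **Lemma 5.1.4 (b)**: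
  `|{A ∈ [C] | A ≥ 0}| · (q - 1) = q^{ℓ(C)} - 1`; `numPosDivisors_mul_eq` — **Lemma 5.1.4 (c)**:
  `A_n (q - 1) = h (q^{n+1-g} - 1)` for `n > 2g - 2`, `∂ ∣ n`.

F. K. Schmidt's theorem `∂ = 1` (Cor. 5.1.11, via constant field extensions) is **not** proved or
needed here; all statements carry `∂` explicitly, exactly as printed in §5.1 up to Prop. 5.1.10.

## Proof notes (deviations from the printed proofs)

* Lemma 5.1.1 is proved inside `F` instead of via `𝔽_q(x)`: a place `v` with `deg v ≤ n` is a
  pole of a fixed transcendental `x`, or a zero of `p(x)` where `p` is the minimal polynomial of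
  `x mod v` over `K` (`deg p ≤ [F_v : K] ≤ n`); poles and zeros are finite in number
  (Cor. 1.3.4, `finite_setOf_ord_ne_zero_of_ne_zero`) and there are finitely many `p`.
* Lemma 5.1.4 (b) is the bijection `ℙ(ℒ(C)) ≃ {A ∈ [C] | A ≥ 0}`, `[x] ↦ (x) + C` (injective
  because `(x) = (y)` forces `x/y ∈ ℒ(0) = K`, Lemma 1.4.7 (a) `riemannRochSpace_zero_eq_bot`;
  surjective by Def. 1.4.3), followed by Mathlib's `Projectivization.card`
  (`|V| - 1 = |ℙ(V)| (q - 1)`) and `Module.natCard_eq_pow_finrank`.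
* Lemma 5.1.4 (c) sums (b) over the fibres of `{A ≥ 0 | deg A = n} → Clⁿ(F)` and uses
  Thm. 1.5.17 (`ell_eq_degree_add_one_sub_genus`, proved in `FunctionFieldAdelesProofs`).

## Mathlib

Mathlib (pin v4.32.0) has no divisor class group or class number of a function field (its
`ClassGroup R` is the ideal class group of a Dedekind domain, which for `R = 𝓞` of a function
field misses the infinite places); searched `classNumber`, `DivisorClass`, `Picard` in
`RingTheory`/`NumberTheory`/`AlgebraicGeometry`. Used: `QuotientAddGroup`, `Projectivization`,
`Projectivization.card`, `Module.natCard_eq_pow_finrank`, `minpoly.natDegree_le`,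
`Polynomial.degreeLTEquiv`.

## References

* H. Stichtenoth, *Algebraic Function Fields and Codes*, 2nd ed., GTM 254 (2009), §5.1,
  pp. 185–188 (Lemma 5.1.1 – Lemma 5.1.4).
* M. Rosen, *Number Theory in Function Fields*, GTM 210 (2002), Ch. 5 (Lemmas 5.5–5.8).
* F. K. Schmidt, *Analytische Zahlentheorie in Körpern der Charakteristik p*, Math. Z. 33 (1931).
-/

noncomputable section

open scoped Classical

namespace Literature.NumberTheory.DiophantineGeometry.AlgFunctionField

universe u v

variable {K : Type u} {F : Type v} [Field K] [Field F] [Algebra K F]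

/-! ### Lemma 5.1.1: finitely many places of bounded degree, finitely many positive divisors
of given degree -/

section Finiteness

variable (K) in
/-- Over a *finite* field `K`, the polynomials of degree `< n` form a finite set (they form the
`K`-subspace `degreeLT K n ≅ Kⁿ`). [folklore] -/
theorem finite_degreeLT [Finite K] (n : ℕ) :
    ((Polynomial.degreeLT K n : Set (Polynomial K))).Finite := by
  have e := (Polynomial.degreeLTEquiv K n).toEquiv
  haveI : Finite (Polynomial.degreeLT K n) := Finite.of_equiv _ e.symm
  exact Set.toFinite _

/-- **Stichtenoth Lemma 5.1.1** (places part): over a finite constant field, an algebraic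
function field has only finitely many places of degree `≤ n`. Proof as printed, phrased inside
`F`: fix `x ∈ F` transcendental over `K`; a place `v` with `deg v ≤ n` is either a pole of `x`,
or `x ∈ O_v` and then the minimal polynomial `p` of `x mod v` over `K` has degree
`≤ [F_v : K] = deg v ≤ n` and `v` is a zero of `p(x) ≠ 0`; poles of `x` and zeros of each `p(x)`
are finite in number (Cor. 1.3.4), and there are finitely many `p` of degree `≤ n`.
[cite: Stichtenoth2009, Lemma 5.1.1] -/
theorem finite_setOf_degree_le [Finite K] [IsAlgFunctionField K F] (n : ℕ) :
    {v : PlaceOver K F | v.degree ≤ n}.Finite := by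
  obtain ⟨x, hx⟩ := IsAlgFunctionField.exists_transcendental (K := K) (F := F)
  have hx0 : x ≠ 0 := fun h => hx (h ▸ isAlgebraic_zero)
  -- the finitely many candidate polynomials
  set P : Set (Polynomial K) := (Polynomial.degreeLT K (n + 1) : Set (Polynomial K)) with hP
  have hPfin : P.Finite := finite_degreeLT K (n + 1)
  -- the covering set
  have hcover : {v : PlaceOver K F | v.degree ≤ n} ⊆
      {v : PlaceOver K F | v.ord x ≠ 0} ∪
        ⋃ p ∈ P, {v : PlaceOver K F | v.ord (Polynomial.aeval x p) ≠ 0} := by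
    intro v hv
    simp only [Set.mem_setOf_eq] at hv
    by_cases hxv : x ∈ v.toValuationSubring
    · right
      haveI : FiniteDimensional K v.residueField :=
        PlaceOver.finiteDimensional_residueField_holds (K := K) (F := F) v
      set xb : v.residueField := IsLocalRing.residue v.toValuationSubring ⟨x, hxv⟩ with hxb
      set p : Polynomial K := minpoly K xb with hp
      have hpdeg : p.natDegree ≤ n := (minpoly.natDegree_le xb).trans hv
      have hpP : p ∈ P := by
        rw [hP, SetLike.mem_coe, Polynomial.mem_degreeLT]
        exact (Polynomial.degree_le_natDegree).trans_lt
          (WithBot.coe_lt_coe.mpr (Nat.lt_succ_of_le hpdeg))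
      simp only [Set.mem_iUnion, Set.mem_setOf_eq]
      refine ⟨p, hpP, ?_⟩
      -- `p(x) ∈ O_v` reduces to `p(x mod v) = 0`, so `ord_v p(x) > 0`
      have hpx_ne : Polynomial.aeval x p ≠ 0 := by
        intro h0
        exact hx (⟨p, minpoly.ne_zero (IsIntegral.of_finite K xb), h0⟩ : IsAlgebraic K x)
      have hmem : (Polynomial.aeval (⟨x, hxv⟩ : v.toValuationSubring) p : F) =
          Polynomial.aeval x p :=
        (Polynomial.aeval_algebraMap_apply F (⟨x, hxv⟩ : v.toValuationSubring) p).symm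
      have hres : IsLocalRing.residue v.toValuationSubring
          (Polynomial.aeval (⟨x, hxv⟩ : v.toValuationSubring) p) = 0 := by
        have h := Polynomial.aeval_algHom_apply
          (IsScalarTower.toAlgHom K v.toValuationSubring v.residueField)
          (⟨x, hxv⟩ : v.toValuationSubring) p
        change Polynomial.aeval xb p = IsLocalRing.residue v.toValuationSubring _ at h
        rw [← h]
        exact minpoly.aeval K xb
      rw [IsLocalRing.residue_eq_zero_iff] at hres
      have hlt : v.valuation (Polynomial.aeval x p) < 1 := by
        rw [← hmem]
        exact (v.toValuationSubring.valuation_lt_one_iff _).mp hres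
      have := (v.valuation_lt_one_iff_ord_pos hpx_ne).mp hlt
      omega
    · left
      simp only [Set.mem_setOf_eq]
      have : ¬ 0 ≤ v.ord x := fun h => hxv ((v.mem_toValuationSubring_iff_ord_nonneg hx0).mpr h)
      omega
  refine Set.Finite.subset (Set.Finite.union ?_ ?_) hcover
  · exact finite_setOf_ord_ne_zero_of_ne_zero hx0
  · refine Set.Finite.biUnion hPfin fun p _ => ?_
    by_cases hp0 : Polynomial.aeval x p = 0
    · have h0 : ∀ w : PlaceOver K F, w.ord (0 : F) = 0 := fun w => by
        have hz : (⟨0, w.toValuationSubring.zero_mem⟩ : w.toValuationSubring) = 0 := rfl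
        simp [PlaceOver.ord, w.toValuationSubring.zero_mem, hz]
      simp [hp0, h0]
    · exact finite_setOf_ord_ne_zero_of_ne_zero hp0

/-- For an effective divisor, each term `D(v) · deg v` is bounded by `deg D`. [folklore] -/
theorem Divisor.apply_mul_degree_le_degree {D : Divisor K F} (hD : 0 ≤ D) (v : PlaceOver K F) :
    D v * (v.degree : ℤ) ≤ D.degree := by
  rw [Divisor.degree_apply, Finsupp.sum]
  by_cases hv : v ∈ D.support
  · refine Finset.single_le_sum (f := fun w => D w * (w.degree : ℤ)) (fun w _ => ?_) hv
    exact mul_nonneg (hD w) (Nat.cast_nonneg _)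
  · rw [Finsupp.notMem_support_iff.mp hv, zero_mul]
    exact Finset.sum_nonneg fun w _ => mul_nonneg (hD w) (Nat.cast_nonneg _)

/-- **Stichtenoth Lemma 5.1.1**: over a finite constant field there are only finitely many
positive divisors of each degree `n` (a positive divisor of degree `n` is supported on the
finitely many places of degree `≤ n`, with coefficients in `[0, n]`).
[cite: Stichtenoth2009, Lemma 5.1.1] -/
theorem finite_setOf_nonneg_degree_eq [Finite K] [IsAlgFunctionField K F] (n : ℤ) :
    {D : Divisor K F | 0 ≤ D ∧ D.degree = n}.Finite := by
  set S : Set (PlaceOver K F) := {v | v.degree ≤ n.toNat} with hSdef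
  have hS : S.Finite := finite_setOf_degree_le n.toNat
  haveI : Finite S := hS.to_subtype
  set T : Set (Divisor K F) := {D | 0 ≤ D ∧ D.degree = n} with hTdef
  -- coefficients and support of a positive divisor of degree `n` are bounded
  have hcoeff : ∀ D ∈ T, ∀ v, 0 ≤ D v ∧ D v ≤ n := by
    rintro D ⟨hD, hdeg⟩ v
    have h0 : 0 ≤ D v := by simpa using hD v
    refine ⟨h0, ?_⟩
    have h1 := Divisor.apply_mul_degree_le_degree hD v
    have h2 : (1 : ℤ) ≤ v.degree := by exact_mod_cast v.one_le_degree
    rw [hdeg] at h1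
    nlinarith
  have hsupp : ∀ D ∈ T, ∀ v, D v ≠ 0 → v ∈ S := by
    rintro D ⟨hD, hdeg⟩ v hv
    simp only [hSdef, Set.mem_setOf_eq]
    have h1 := Divisor.apply_mul_degree_le_degree hD v
    have h0 : 0 ≤ D v := by simpa using hD v
    have hv1 : 1 ≤ D v := by omega
    have h3 : (v.degree : ℤ) ≤ D.degree := le_trans (by nlinarith) h1
    rw [hdeg] at h3
    omega
  -- inject `T` into the finite type `S → [0, n]`
  let φ : T → S → Set.Icc (0 : ℤ) n := fun D v => ⟨D.1 v.1, hcoeff D.1 D.2 v.1⟩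
  have hφ : Function.Injective φ := by
    rintro ⟨D, hD⟩ ⟨D', hD'⟩ h
    ext v
    by_cases hv : v ∈ S
    · have := congr_fun h ⟨v, hv⟩
      simpa [φ] using this
    · have h1 : D v = 0 := by by_contra h1; exact hv (hsupp D hD v h1)
      have h2 : D' v = 0 := by by_contra h2; exact hv (hsupp D' hD' v h2)
      simp [h1, h2]
  haveI : Finite T := Finite.of_injective φ hφ
  exact Set.toFinite T

end Finiteness

/-! ### The divisor class group, its degree map, and the index `∂` (Stichtenoth §5.1, (5.3)) -/

section ClassGroup

/-- `(1) = 0`. [folklore] -/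
theorem principalDivisor_one [IsAlgFunctionField K F] : principalDivisor K (1 : F) = 0 := by
  ext v
  rw [principalDivisor_apply_of_ne_zero one_ne_zero, PlaceOver.ord_one]
  rfl

/-- `(c) = 0` for a nonzero constant `c ∈ K` (Stichtenoth Prop. 1.1.5: constants have neither
zeros nor poles). [cite: Stichtenoth2009, Prop. 1.1.5(c)] -/
theorem principalDivisor_algebraMap [IsAlgFunctionField K F] {c : K} (hc : c ≠ 0) :
    principalDivisor K (algebraMap K F c) = 0 := by
  ext v
  rw [principalDivisor_apply_of_ne_zero ((map_ne_zero _).mpr hc), PlaceOver.ord_algebraMap_holds v hc]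
  rfl

/-- `(c • x) = (x)` for a nonzero constant `c`. [folklore] -/
theorem principalDivisor_smul [IsAlgFunctionField K F] {c : K} (hc : c ≠ 0) {x : F} (hx : x ≠ 0) :
    principalDivisor K (c • x) = principalDivisor K x := by
  rw [Algebra.smul_def, principalDivisor_mul ((map_ne_zero _).mpr hc) hx,
    principalDivisor_algebraMap hc, zero_add]

/-- A nonzero element with principal divisor `0` is a constant, when `K` is the full constant
field (Stichtenoth Lemma 1.4.7 (a): `ℒ(0) = K`). [cite: Stichtenoth2009, Lemma 1.4.7(a)] -/
theorem exists_eq_algebraMap_of_principalDivisor_eq_zero [IsAlgFunctionField K F]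
    [IsIntegrallyClosedIn K F] {x : F} (hx : x ≠ 0) (h : principalDivisor K x = 0) :
    ∃ c : K, c ≠ 0 ∧ algebraMap K F c = x := by
  have hmem : x ∈ riemannRochSpace (0 : Divisor K F) := by
    rw [mem_riemannRochSpace_iff_nonneg _ hx, h, add_zero]
  rw [riemannRochSpace_zero_eq_bot, Subalgebra.mem_toSubmodule, Algebra.mem_bot] at hmem
  obtain ⟨c, rfl⟩ := hmem
  exact ⟨c, fun hc => hx (by rw [hc, map_zero]), rfl⟩

/-- `0` is a principal divisor (`(1) = 0`). [folklore] -/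
theorem Divisor.isPrincipal_zero [IsAlgFunctionField K F] : (0 : Divisor K F).IsPrincipal :=
  ⟨1, one_ne_zero, principalDivisor_one⟩

/-- Principal divisors are closed under addition (`(x) + (y) = (xy)`, Stichtenoth Def. 1.4.3).
[cite: Stichtenoth2009, Def. 1.4.3] -/
theorem Divisor.IsPrincipal.add [IsAlgFunctionField K F] {D D' : Divisor K F}
    (hD : D.IsPrincipal) (hD' : D'.IsPrincipal) : (D + D').IsPrincipal := by
  obtain ⟨x, hx, rfl⟩ := hD
  obtain ⟨y, hy, rfl⟩ := hD'
  exact ⟨x * y, mul_ne_zero hx hy, principalDivisor_mul hx hy⟩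

/-- Principal divisors are closed under negation (`-(x) = (x⁻¹)`). [cite: Stichtenoth2009, Def. 1.4.3] -/
theorem Divisor.IsPrincipal.neg [IsAlgFunctionField K F] {D : Divisor K F} (hD : D.IsPrincipal) :
    (-D).IsPrincipal := by
  obtain ⟨x, hx, rfl⟩ := hD
  exact ⟨x⁻¹, inv_ne_zero hx, principalDivisor_inv hx⟩

variable (K F) in
/-- The group `Princ(F/K)` of principal divisors (Stichtenoth Def. 1.4.3), as the subgroup of
`Div(F/K)` generated by the principal divisors `(x)`, `x ≠ 0`; for an algebraic function field
of one variable it consists exactly of them (`mem_principalDivisors_iff`). [cite: Stichtenoth2009, Def. 1.4.3] -/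
def principalDivisors : AddSubgroup (Divisor K F) :=
  AddSubgroup.closure {D | D.IsPrincipal}

/-- Membership in `Princ(F/K)`: `D` is principal (Stichtenoth Def. 1.4.3: the principal divisors
form a subgroup). [cite: Stichtenoth2009, Def. 1.4.3] -/
theorem mem_principalDivisors_iff [IsAlgFunctionField K F] {D : Divisor K F} :
    D ∈ principalDivisors K F ↔ D.IsPrincipal := by
  refine ⟨fun h => ?_, fun h => AddSubgroup.subset_closure h⟩
  induction h using AddSubgroup.closure_induction with
  | mem _ h => exact h
  | zero => exact Divisor.isPrincipal_zero
  | add _ _ _ _ h₁ h₂ => exact h₁.add h₂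
  | neg _ _ h => exact h.neg

variable (K F) in
/-- The divisor class group `Cl(F/K) = Div(F/K) / Princ(F/K)` (Stichtenoth Def. 1.4.3 and §5.1).
[cite: Stichtenoth2009, Def. 1.4.3] -/
abbrev DivisorClass : Type v :=
  Divisor K F ⧸ principalDivisors K F

namespace DivisorClass

/-- The class `[D]` of a divisor. [folklore] -/
abbrev mk (D : Divisor K F) : DivisorClass K F :=
  QuotientAddGroup.mk D

/-- `[D] = [D'] ↔ D ∼ D'` (Stichtenoth §5.1: "`A ∼ B ⟺ [A] = [B]`"). [cite: Stichtenoth2009, §5.1 (p. 186)] -/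
theorem mk_eq_mk_iff [IsAlgFunctionField K F] {D D' : Divisor K F} :
    mk D = mk D' ↔ D.IsLinearlyEquivalent D' := by
  rw [QuotientAddGroup.eq, mem_principalDivisors_iff, Divisor.IsLinearlyEquivalent]
  constructor
  · intro h
    have := h.neg
    rwa [neg_add_rev, neg_neg, add_comm, ← sub_eq_add_neg] at this
  · intro h
    have := h.neg
    rwa [neg_sub, sub_eq_neg_add] at this

/-- The degree of a divisor class, `deg [D] := deg D` (well defined since principal divisors have
degree `0`, Stichtenoth Cor. 1.4.12). [cite: Stichtenoth2009, §5.1 (p. 186)] -/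
def degree [IsAlgFunctionField K F] : DivisorClass K F →+ ℤ :=
  QuotientAddGroup.lift (principalDivisors K F) Divisor.degree fun D hD => by
    obtain ⟨x, hx, rfl⟩ := mem_principalDivisors_iff.mp hD
    exact degree_principalDivisor_eq_zero hx

/-- `deg [D] = deg D` (definitional). [folklore] -/
@[simp]
theorem degree_mk [IsAlgFunctionField K F] (D : Divisor K F) : degree (mk D) = D.degree :=
  rfl

/-- The dimension of a divisor class, `ℓ([D]) := ℓ(D)` (well defined by Stichtenoth
Lemma 1.4.6 (b)). [cite: Stichtenoth2009, §5.1 (p. 186)] -/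
def ell [IsAlgFunctionField K F] : DivisorClass K F → ℕ :=
  Quotient.lift (AlgFunctionField.ell (K := K) (F := F)) fun D D' h => by
    apply ell_congr_of_isLinearlyEquivalent_holds
    rw [← mk_eq_mk_iff]
    exact Quotient.sound h

/-- `ℓ([D]) = ℓ(D)` (definitional). [folklore] -/
@[simp]
theorem ell_mk [IsAlgFunctionField K F] (D : Divisor K F) : ell (mk D) = AlgFunctionField.ell D :=
  rfl

end DivisorClass

variable (K F) in
/-- The index `∂ = min {deg A | A ∈ Div(F), deg A > 0}` of the image of the degree map
(Stichtenoth (5.3)); junk value `0` if there is no divisor of positive degree (never for a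
function field: `minPosDegree_pos`). By F. K. Schmidt's theorem (Stichtenoth Cor. 5.1.11)
`∂ = 1`; this is not proved here. [cite: Stichtenoth2009, §5.1, (5.3)] -/
def minPosDegree : ℕ :=
  sInf {n : ℕ | 0 < n ∧ ∃ D : Divisor K F, D.degree = n}

/-- The defining set of `∂` is nonempty: a place `P` gives the divisor `P` of degree
`deg P ≥ 1`. [folklore] -/
theorem minPosDegree_spec [IsAlgFunctionField K F] :
    0 < minPosDegree K F ∧ ∃ D : Divisor K F, D.degree = minPosDegree K F := by
  have hne : {n : ℕ | 0 < n ∧ ∃ D : Divisor K F, D.degree = n}.Nonempty := by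
    obtain ⟨P⟩ := nonempty_placeOver (K := K) (F := F)
    refine ⟨P.degree, P.one_le_degree, Finsupp.single P 1, ?_⟩
    rw [Divisor.degree_single, one_mul]
  exact Nat.sInf_mem hne

/-- `∂ > 0`. [cite: Stichtenoth2009, §5.1, (5.3)] -/
theorem minPosDegree_pos [IsAlgFunctionField K F] : 0 < minPosDegree K F :=
  minPosDegree_spec.1

/-- The degree of every divisor is a multiple of `∂` (Stichtenoth §5.1: "the degree of each
divisor of `F/𝔽_q` is a multiple of `∂`"). [cite: Stichtenoth2009, §5.1, after (5.3)] -/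
theorem minPosDegree_dvd_degree [IsAlgFunctionField K F] (D : Divisor K F) :
    (minPosDegree K F : ℤ) ∣ D.degree := by
  obtain ⟨hpos, D₀, hD₀⟩ := minPosDegree_spec (K := K) (F := F)
  set d : ℤ := (minPosDegree K F : ℤ) with hd
  have hd0 : (0 : ℤ) < d := by rw [hd]; exact_mod_cast hpos
  -- the remainder `deg D mod ∂` is the degree of `D - (deg D / ∂) • D₀`
  set r : ℤ := D.degree % d with hr
  have hr0 : 0 ≤ r := Int.emod_nonneg _ hd0.ne'
  have hrd : r < d := Int.emod_lt_of_pos _ hd0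
  have hdeg : (D - (D.degree / d) • D₀).degree = r := by
    rw [map_sub, map_zsmul, hD₀, smul_eq_mul, hr, Int.emod_def, mul_comm]
  by_contra hndvd
  have hrne : r ≠ 0 := fun h0 => hndvd (Int.dvd_of_emod_eq_zero h0)
  have hrpos : 0 < r := lt_of_le_of_ne hr0 (Ne.symm hrne)
  have hmem : r.toNat ∈ {n : ℕ | 0 < n ∧ ∃ D : Divisor K F, D.degree = n} :=
    ⟨by omega, D - (D.degree / d) • D₀, by rw [hdeg]; omega⟩
  have hle : minPosDegree K F ≤ r.toNat := Nat.sInf_le hmem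
  omega

/-- The divisor classes of degree `n`, `Clⁿ(F) = {[C] | deg [C] = n}` (Stichtenoth, proof of
Prop. 5.1.3). [cite: Stichtenoth2009, Prop. 5.1.3 (proof)] -/
def classesOfDegree [IsAlgFunctionField K F] (n : ℤ) : Set (DivisorClass K F) :=
  {c | DivisorClass.degree c = n}

/-- Membership in `Clⁿ(F)` (definitional). [folklore] -/
@[simp]
theorem mem_classesOfDegree [IsAlgFunctionField K F] {n : ℤ} {c : DivisorClass K F} :
    c ∈ classesOfDegree (K := K) (F := F) n ↔ DivisorClass.degree c = n :=
  Iff.rfl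

variable (K F) in
/-- The class number `h = h_F = |Cl⁰(F)|` (Stichtenoth Prop. 5.1.3), as the `Nat.card` of the
classes of degree zero (finite: `finite_classesOfDegree`). [cite: Stichtenoth2009, Prop. 5.1.3] -/
def classNumber [IsAlgFunctionField K F] : ℕ :=
  Nat.card (classesOfDegree (K := K) (F := F) 0)

end ClassGroup

/-! ### Prop. 5.1.3: finiteness of the divisor classes of given degree -/

section Classes

variable [IsAlgFunctionField K F]

/-- **Stichtenoth (5.1)/(5.2)**: a divisor class of degree `≥ g` contains a positive divisor:
`ℓ(C) ≥ deg C + 1 - g ≥ 1`, and for `0 ≠ x ∈ ℒ(C)` the divisor `(x) + C ≥ 0` lies in `[C]`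
(Remark 1.4.5 (b)). [cite: Stichtenoth2009, Prop. 5.1.3 (proof, (5.1)–(5.2))] -/
theorem exists_nonneg_isLinearlyEquivalent {D : Divisor K F} (hD : (genus K F : ℤ) ≤ D.degree) :
    ∃ A : Divisor K F, 0 ≤ A ∧ A.IsLinearlyEquivalent D := by
  have hℓ := degree_add_one_sub_genus_le_ell D
  have hℓ1 : 0 < ell D := by
    have : (1 : ℤ) ≤ ell D := by linarith
    exact_mod_cast this
  haveI := finiteDimensional_riemannRochSpace_of_isAlgFunctionField (K := K) D
  obtain ⟨y, hy⟩ := Module.finrank_pos_iff_exists_ne_zero.mp hℓ1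
  have hy0 : (y : F) ≠ 0 := fun h => hy (Subtype.ext h)
  refine ⟨principalDivisor K (y : F) + D, (mem_riemannRochSpace_iff_nonneg D hy0).mp y.2, ?_⟩
  exact ⟨y, hy0, by abel⟩

/-- **Stichtenoth Prop. 5.1.3** (finiteness of `Clⁿ(F)` for every `n`): the classes of degree
`N ≥ g` are classes of positive divisors of degree `N`, finite in number by Lemma 5.1.1, and
`[C] ↦ [C + B]` (`deg B = N - n`) injects `Clⁿ(F)` into `Cl^N(F)`; here `B = m · P` for a place
`P`. [cite: Stichtenoth2009, Prop. 5.1.3] -/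
theorem finite_classesOfDegree [Finite K] (n : ℤ) :
    (classesOfDegree (K := K) (F := F) n).Finite := by
  obtain ⟨P⟩ := nonempty_placeOver (K := K) (F := F)
  set m : ℕ := n.natAbs + genus K F with hm
  set B : Divisor K F := (m : ℤ) • Finsupp.single P 1 with hB
  set N : ℤ := n + B.degree with hN
  have hBdeg : B.degree = (m : ℤ) * P.degree := by
    rw [hB, map_zsmul, Divisor.degree_single, one_mul, smul_eq_mul]
  have hgN : (genus K F : ℤ) ≤ N := by
    have h1 : (1 : ℤ) ≤ P.degree := by exact_mod_cast P.one_le_degree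
    have h2 : (m : ℤ) ≤ (m : ℤ) * P.degree := by nlinarith
    have h3 : (m : ℤ) = |n| + genus K F := by rw [hm]; push_cast; rfl
    rw [hN, hBdeg]
    cases abs_cases n <;> linarith
  -- classes of degree `N` are classes of positive divisors of degree `N`
  have hfinN : (classesOfDegree (K := K) (F := F) N).Finite := by
    refine ((finite_setOf_nonneg_degree_eq (K := K) (F := F) N).image
      DivisorClass.mk).subset fun c hc => ?_
    induction c using QuotientAddGroup.induction_on with
    | H D =>
      rw [mem_classesOfDegree, DivisorClass.degree_mk] at hc
      obtain ⟨A, hA, hAD⟩ := exists_nonneg_isLinearlyEquivalent (D := D) (by rw [hc]; exact hgN)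
      refine ⟨A, ⟨hA, ?_⟩, DivisorClass.mk_eq_mk_iff.mpr hAD⟩
      rw [Divisor.degree_eq_of_isLinearlyEquivalent hAD, hc]
  -- translation by `[B]` injects `Clⁿ` into `Cl^N`
  refine Set.Finite.of_finite_image (f := fun c => c + DivisorClass.mk B) (hfinN.subset ?_)
    fun _ _ _ _ h => add_right_cancel h
  rintro _ ⟨c, hc, rfl⟩
  rw [mem_classesOfDegree] at hc ⊢
  rw [map_add, hc, DivisorClass.degree_mk]

/-- The type of divisor classes of degree `n` is finite. [cite: Stichtenoth2009, Prop. 5.1.3] -/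
instance finite_classesOfDegree' [Finite K] (n : ℤ) :
    Finite (classesOfDegree (K := K) (F := F) n) :=
  (finite_classesOfDegree n).to_subtype

/-- `Clⁿ(F) = ∅` unless `∂ ∣ n` (every degree is a multiple of `∂`).
[cite: Stichtenoth2009, Lemma 5.1.4(a)] -/
theorem classesOfDegree_eq_empty_of_not_dvd {n : ℤ} (h : ¬ (minPosDegree K F : ℤ) ∣ n) :
    classesOfDegree (K := K) (F := F) n = ∅ := by
  ext c
  simp only [mem_classesOfDegree, Set.mem_empty_iff_false, iff_false]
  induction c using QuotientAddGroup.induction_on with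
  | H D =>
    rw [DivisorClass.degree_mk]
    intro hD
    exact h (hD ▸ minPosDegree_dvd_degree D)

/-- `|Clⁿ(F)| = h` whenever `∂ ∣ n`: translation by `[k · D₀]`, `deg D₀ = ∂`, `n = k ∂`, is a
bijection `Cl⁰(F) → Clⁿ(F)` (Stichtenoth, proof of Prop. 5.1.3: "`[A] ↦ [A + B]` is bijective
(this is trivial)"). [cite: Stichtenoth2009, Prop. 5.1.3 (proof) and Lemma 5.1.4(c)] -/
theorem natCard_classesOfDegree_of_dvd {n : ℤ} (h : (minPosDegree K F : ℤ) ∣ n) :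
    Nat.card (classesOfDegree (K := K) (F := F) n) = classNumber K F := by
  obtain ⟨k, hk⟩ := h
  obtain ⟨-, D₀, hD₀⟩ := minPosDegree_spec (K := K) (F := F)
  have hdeg : DivisorClass.degree (DivisorClass.mk (k • D₀)) = n := by
    rw [DivisorClass.degree_mk, map_zsmul, hD₀, smul_eq_mul, hk, mul_comm]
  refine (Nat.card_congr ?_).symm
  refine
    { toFun := fun c => ⟨c.1 + DivisorClass.mk (k • D₀), ?_⟩
      invFun := fun c => ⟨c.1 - DivisorClass.mk (k • D₀), ?_⟩
      left_inv := fun c => by simp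
      right_inv := fun c => by simp }
  · have hc := c.2
    rw [mem_classesOfDegree] at hc ⊢
    rw [map_add, hc, hdeg, zero_add]
  · have hc := c.2
    rw [mem_classesOfDegree] at hc ⊢
    rw [map_sub, hc, hdeg, sub_self]

/-- `h ≥ 1` (the class of `0` has degree `0`). [cite: Stichtenoth2009, Prop. 5.1.3] -/
theorem classNumber_pos [Finite K] : 0 < classNumber K F := by
  rw [classNumber]
  haveI : Nonempty (classesOfDegree (K := K) (F := F) 0) :=
    ⟨⟨DivisorClass.mk 0, by rw [mem_classesOfDegree, DivisorClass.degree_mk, map_zero]⟩⟩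
  exact Nat.card_pos

end Classes

/-! ### Lemma 5.1.4: the numbers `A_n` of positive divisors of degree `n` -/

section PositiveDivisors

variable (K F) in
/-- `A_n = |{A ∈ Div(F) | A ≥ 0 and deg A = n}|`, the number of positive divisors of degree `n`
(Stichtenoth (5.4); finite by Lemma 5.1.1, `finite_setOf_nonneg_degree_eq`).
[cite: Stichtenoth2009, §5.1, (5.4)] -/
def numPosDivisors (n : ℕ) : ℕ :=
  Nat.card {D : Divisor K F // 0 ≤ D ∧ D.degree = n}

/-- The type of positive divisors of degree `n` is finite (Lemma 5.1.1).
[cite: Stichtenoth2009, Lemma 5.1.1] -/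
instance finite_nonneg_degree_eq [Finite K] [IsAlgFunctionField K F] (n : ℤ) :
    Finite {D : Divisor K F // 0 ≤ D ∧ D.degree = n} :=
  (finite_setOf_nonneg_degree_eq n).to_subtype

/-- `A_0 = 1`: the only positive divisor of degree `0` is `0` (Stichtenoth §5.1: "For instance,
`A_0 = 1`"). [cite: Stichtenoth2009, §5.1, after (5.4)] -/
theorem numPosDivisors_zero [IsAlgFunctionField K F] : numPosDivisors K F 0 = 1 := by
  rw [numPosDivisors, Nat.cast_zero, Nat.card_eq_one_iff_unique]
  refine ⟨⟨fun D D' => ?_⟩, ⟨⟨0, le_rfl, map_zero _⟩⟩⟩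
  have key : ∀ D : Divisor K F, 0 ≤ D → D.degree = 0 → D = 0 := by
    intro D hD hdeg
    ext v
    have h1 := Divisor.apply_mul_degree_le_degree hD v
    have h0 : 0 ≤ D v := by simpa using hD v
    have h2 : (1 : ℤ) ≤ v.degree := by exact_mod_cast v.one_le_degree
    rw [hdeg] at h1
    change D v = 0
    nlinarith
  exact Subtype.ext ((key D.1 D.2.1 D.2.2).trans (key D'.1 D'.2.1 D'.2.2).symm)

/-- **Stichtenoth Lemma 5.1.4 (a)**: `A_n = 0` if `∂ ∤ n`. [cite: Stichtenoth2009, Lemma 5.1.4(a)] -/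
theorem numPosDivisors_eq_zero_of_not_dvd [IsAlgFunctionField K F] {n : ℕ}
    (h : ¬ minPosDegree K F ∣ n) : numPosDivisors K F n = 0 := by
  rw [numPosDivisors, Nat.card_eq_zero]
  left
  refine ⟨fun D => h ?_⟩
  have := minPosDegree_dvd_degree D.1
  rw [D.2.2] at this
  exact_mod_cast this

variable [IsAlgFunctionField K F] [IsIntegrallyClosedIn K F]

/-- **Stichtenoth Lemma 5.1.4 (b)**: for a divisor `C`, the positive divisors in the class `[C]`
are the `(x) + C` with `0 ≠ x ∈ ℒ(C)`, two such `x` giving the same divisor iff they differ by a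
nonzero constant factor; hence `|{A ∈ [C] | A ≥ 0}| · (q - 1) = q^{ℓ(C)} - 1`. Formalised through
the bijection with the projective space `ℙ(ℒ(C))` and Mathlib's `Projectivization.card`.
[cite: Stichtenoth2009, Lemma 5.1.4(b)] -/
theorem natCard_nonneg_isLinearlyEquivalent_mul [Finite K] (C : Divisor K F) :
    Nat.card {A : Divisor K F // 0 ≤ A ∧ A.IsLinearlyEquivalent C} * (Nat.card K - 1) =
      Nat.card K ^ ell C - 1 := by
  set L := riemannRochSpace (K := K) C with hL
  haveI : FiniteDimensional K L := finiteDimensional_riemannRochSpace_of_isAlgFunctionField C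
  -- the map `ℙ(ℒ(C)) → {A ∈ [C] | A ≥ 0}`, `[x] ↦ (x) + C`
  have hrep0 : ∀ p : Projectivization K L, ((p.rep : L) : F) ≠ 0 := fun p h =>
    p.rep_nonzero (Subtype.ext h)
  let ψ : Projectivization K L → {A : Divisor K F // 0 ≤ A ∧ A.IsLinearlyEquivalent C} :=
    fun p => ⟨principalDivisor K ((p.rep : L) : F) + C,
      (mem_riemannRochSpace_iff_nonneg C (hrep0 p)).mp (p.rep : L).2,
      ⟨((p.rep : L) : F), hrep0 p, by abel⟩⟩
  have hψ : Function.Bijective ψ := by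
    constructor
    · intro p p' h
      have h1 : principalDivisor K ((p.rep : L) : F) = principalDivisor K ((p'.rep : L) : F) := by
        have := congrArg (fun A : {A : Divisor K F // 0 ≤ A ∧ A.IsLinearlyEquivalent C} => A.1) h
        simpa [ψ] using this
      have h2 : principalDivisor K (((p.rep : L) : F) * ((p'.rep : L) : F)⁻¹) = 0 := by
        rw [principalDivisor_mul (hrep0 p) (inv_ne_zero (hrep0 p')), principalDivisor_inv (hrep0 p'),
          h1, add_neg_cancel]
      obtain ⟨c, hc, hcx⟩ := exists_eq_algebraMap_of_principalDivisor_eq_zero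
        (mul_ne_zero (hrep0 p) (inv_ne_zero (hrep0 p'))) h2
      have h3 : (Units.mk0 c hc) • (p'.rep : L) = p.rep := by
        apply Subtype.ext
        change c • ((p'.rep : L) : F) = ((p.rep : L) : F)
        rw [Algebra.smul_def, hcx, inv_mul_cancel_right₀ (hrep0 p')]
      rw [← p.mk_rep, ← p'.mk_rep, Projectivization.mk_eq_mk_iff]
      exact ⟨Units.mk0 c hc, h3⟩
    · rintro ⟨A, hA, x, hx0, hxA⟩
      have hxL : x ∈ L := by
        rw [hL, mem_riemannRochSpace_iff_nonneg C hx0, hxA, sub_add_cancel]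
        exact hA
      have hxL0 : (⟨x, hxL⟩ : L) ≠ 0 := fun h => hx0 (congrArg Subtype.val h)
      refine ⟨Projectivization.mk K (⟨x, hxL⟩ : L) hxL0, ?_⟩
      obtain ⟨a, ha⟩ := (Projectivization.mk_eq_mk_iff K _ _ (Projectivization.rep_nonzero _)
        hxL0).mp (Projectivization.mk_rep (Projectivization.mk K (⟨x, hxL⟩ : L) hxL0))
      apply Subtype.ext
      change principalDivisor K (((Projectivization.mk K (⟨x, hxL⟩ : L) hxL0).rep : L) : F) + C = A
      have hrep : (((Projectivization.mk K (⟨x, hxL⟩ : L) hxL0).rep : L) : F) = (a : K) • x := by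
        rw [← ha]; rfl
      rw [hrep, principalDivisor_smul a.ne_zero hx0, hxA, sub_add_cancel]
  have hcard : Nat.card {A : Divisor K F // 0 ≤ A ∧ A.IsLinearlyEquivalent C} =
      Nat.card (Projectivization K L) := (Nat.card_congr (Equiv.ofBijective ψ hψ)).symm
  rw [hcard, ← Projectivization.card K L, ell, ← hL, Module.natCard_eq_pow_finrank (K := K) (V := L)]

/-- **Stichtenoth Lemma 5.1.4 (c)**: for `n > 2g - 2` with `∂ ∣ n`,
`A_n · (q - 1) = h · (q^{n+1-g} - 1)`: the `h` classes of degree `n` each contain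
`(q^{ℓ([C])} - 1)/(q - 1)` positive divisors, and `ℓ([C]) = n + 1 - g` by Riemann–Roch
(Thm. 1.5.17). [cite: Stichtenoth2009, Lemma 5.1.4(c)] -/
theorem numPosDivisors_mul_eq [Finite K] {n : ℕ} (hn : 2 * genus K F < n + 2)
    (hdvd : minPosDegree K F ∣ n) :
    numPosDivisors K F n * (Nat.card K - 1) =
      classNumber K F * (Nat.card K ^ (n + 1 - genus K F) - 1) := by
  set T := {D : Divisor K F // 0 ≤ D ∧ D.degree = n} with hT
  set Cl := classesOfDegree (K := K) (F := F) n with hCl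
  haveI : Fintype T := Fintype.ofFinite T
  haveI : Fintype Cl := Fintype.ofFinite Cl
  -- the class map `T → Clⁿ`
  let π : T → Cl := fun D => ⟨DivisorClass.mk D.1, by
    rw [hCl, mem_classesOfDegree, DivisorClass.degree_mk, D.2.2]⟩
  -- each fibre has `(q^{n+1-g} - 1)/(q-1)` elements
  have hfib : ∀ c : Cl, Fintype.card {D : T // π D = c} * (Nat.card K - 1) =
      Nat.card K ^ (n + 1 - genus K F) - 1 := by
    intro c
    obtain ⟨c, hc⟩ := c
    induction c using QuotientAddGroup.induction_on with
    | H C =>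
      rw [hCl, mem_classesOfDegree, DivisorClass.degree_mk] at hc
      have hℓ : ell C = n + 1 - genus K F := by
        have h1 := ell_eq_degree_add_one_sub_genus (K := K) (F := F) (A := C) (by rw [hc]; omega)
        rw [hc] at h1
        omega
      rw [← hℓ, ← natCard_nonneg_isLinearlyEquivalent_mul C, Fintype.card_eq_nat_card]
      congr 1
      refine Nat.card_congr ?_
      refine
        { toFun := fun D => ⟨D.1.1, D.1.2.1, DivisorClass.mk_eq_mk_iff.mp (congrArg Subtype.val D.2)⟩
          invFun := fun A => ⟨⟨A.1, A.2.1, ?_⟩, Subtype.ext (DivisorClass.mk_eq_mk_iff.mpr A.2.2)⟩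
          left_inv := fun D => rfl
          right_inv := fun A => rfl }
      rw [Divisor.degree_eq_of_isLinearlyEquivalent A.2.2, hc]
  -- sum over the fibres
  have hsum : Fintype.card T = ∑ c : Cl, Fintype.card {D : T // π D = c} := by
    rw [← Fintype.card_sigma]
    exact Fintype.card_congr (Equiv.sigmaFiberEquiv π).symm
  rw [numPosDivisors, ← hT, ← Fintype.card_eq_nat_card, hsum, Finset.sum_mul,
    Finset.sum_congr rfl fun c _ => hfib c, Finset.sum_const, Finset.card_univ, smul_eq_mul,
    ← natCard_classesOfDegree_of_dvd (n := n) (by exact_mod_cast hdvd), ← hCl,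
    Fintype.card_eq_nat_card]

end PositiveDivisors


end Literature.NumberTheory.DiophantineGeometry.AlgFunctionField

end
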